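import Summits.ResolutionOfSingularities.ResolutionOfSingularities.Theorems.FrobeniusClosingPatchingRelPerfectDepthOneExceptionalFormat
import Summits.ResolutionOfSingularities.ResolutionOfSingularities.Theorems.FrobeniusClosingPatchingRelPerfectCoreRungSquarePlusLinearCharts
import Literature.AlgebraicGeometry.Resolution.ExceptionalDivisorRegularGlobal
import Literature.AlgebraicGeometry.Resolution.BlowupExceptionalFibreIrreducible
import Literature.AlgebraicGeometry.Resolution.NormalCrossingsStrictification
import Literature.AlgebraicGeometry.Resolution.ResolutionOfComponentsRegularLocus
import Literature.AlgebraicGeometry.Resolution.CofinalityFromPrincipalization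
import Literature.AlgebraicGeometry.Resolution.ExcellentRingsFieldProofs
import Literature.AlgebraicGeometry.Resolution.SigmaMaxEliminationInDim
import Literature.AlgebraicGeometry.Resolution.GenericFibreResolutionDatum
import Literature.AlgebraicGeometry.Resolution.HypersurfaceRestriction
import Literature.AlgebraicGeometry.Resolution.RegularSystemOfParameters
import HarnessLib

/-!
# Crux `PatchingRelPerfect` (stmt-ResolutionOfSingularities-16161), chain w52 — programme r-d1,
# piece I1 (`ExceptionalPackage`), part 2: the exceptional divisor of the point blow-up of a
# regular local ring — regular, integral, Noetherian, excellent, over the closed point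

[OURS · L1 W5.2 · rung tool] CHAIN.md v1.5 §2 (row stub-3).  For `S` regular local,
`X = Bl_𝔪 Spec S` (`affineBlowup 𝔪`, `g = affineBlowup.π 𝔪`) and the exceptional divisor
`E = V(𝔪𝒪_X)` (`((𝔪~).comap g).subscheme`, inclusion `i = subschemeι`), PROVED — the fields of
plan-1's `DepthOneInvariant` at the initial state and the side conditions of `ExceptionalPackage`,
as standalone theorems (the packaging BY NAME waits for the typed targets file
`…DepthOneTargets.lean` to land):

* `isNoetherian_blowup`, `isRegular_blowup` — `X` is Noetherian and regular
  (`isNoetherian_of_isBlowup`; Liu 8.1.19 (a), tree `IsBlowup.isRegular_of_isRegular_subscheme`);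
* `isRegular_exceptional`, `isReduced_exceptional`, `isNoetherian_exceptional` — `E` is regular,
  reduced, Noetherian (`IsBlowup.isRegular_subscheme_comap_of_isQuasiRegular`, Liu 8.1.19 (b));
* `irreducibleSpace_exceptional`, `isIntegral_exceptional` — `E` is irreducible
  (`affineBlowup.isIrreducible_preimage_of_isQuasiRegular`) hence integral;
* `exists_hom_exceptional_residueField`, `isExcellent_exceptional` — `E` is of finite type over
  the residue field `κ = S/𝔪` (the composite `E → X → Spec S` kills `𝔪`, universal property of
  the closed immersion `Spec κ → Spec S`), hence EXCELLENT
  (`Scheme.IsExcellent.of_locallyOfFiniteType`, a field being an excellent ring) — `S` itself is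
  NOT assumed excellent;
* `ker_subschemeι_isEffectiveCartier`, `map_exceptional_eq_closedPoint`.

Not done here: `topologicalKrullDim E = 3` (flagged to plan-1).  Nothing here is a statement of the
manuscript under review.

## References

* Q. Liu, *Algebraic Geometry and Arithmetic Curves*, OUP 2002, Thm. 8.1.19 (a), (b). [Liu2002]
* A. Grothendieck, EGA IV₂, Prop. 7.8.6 (i) (finite type over excellent is excellent). [EGAIV2]
-/

-- `Summit.<Summit>.<Sub>.Theorems` with `Sub = Summit` (single-conjunct summit, D-0017)
set_option linter.dupNamespace false

noncomputable section

open CategoryTheory CategoryTheory.Limits AlgebraicGeometry Literature.AlgebraicGeometry.Resolution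
open IsLocalRing TopologicalSpace

namespace Summit.ResolutionOfSingularities.ResolutionOfSingularities.Theorems

namespace DepthOne

universe u

section Exceptional

variable {S : Type u} [CommRing S] [IsRegularLocalRing S] {m : ℕ} (y : Fin (m + 1) → S)
  (hy : Ideal.span (Set.range y) = IsLocalRing.maximalIdeal S)
  (hd : (IsLocalRing.maximalIdeal S).spanFinrank = m + 1)

local notation3 "M" => Ideal.span (Set.range y)
local notation3 "X" => affineBlowup (Ideal.span (Set.range y))
local notation3 "g" => affineBlowup.π (Ideal.span (Set.range y))
local notation3 "𝓔" => (affineBlowup.idealSheaf (Ideal.span (Set.range y))).comap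
  (affineBlowup.π (Ideal.span (Set.range y)))

/-- **`X = Bl_𝔪 Spec S` is Noetherian.** [folklore] -/
theorem isNoetherian_blowup : IsNoetherian X :=
  isNoetherian_of_isBlowup (affineBlowup.isBlowup (M))

include hy in
/-- **`X = Bl_𝔪 Spec S` is regular** (Liu 8.1.19 (a): regular centre `Spec κ` in the regular
`Spec S`). [cite: Liu2002, Thm. 8.1.19 (a)] -/
theorem isRegular_blowup : Scheme.IsRegular X := by
  haveI : IsRegularRing S := isRegularRing_of_isRegularLocalRing S
  haveI : (M).IsMaximal := hy ▸ IsLocalRing.maximalIdeal.isMaximal S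
  haveI : IsRegularRing (S ⧸ M) := by letI := Ideal.Quotient.field (M); infer_instance
  exact isRegular_of_isBlowup_idealSheaf_of_quotient (M) (affineBlowup.isBlowup (M))

include hy hd in
/-- **The exceptional divisor `E` is regular** (Liu 8.1.19 (b), tree
`IsBlowup.isRegular_subscheme_comap_of_isQuasiRegular`). [cite: Liu2002, Thm. 8.1.19 (b)] -/
theorem isRegular_exceptional : Scheme.IsRegular (𝓔).subscheme := by
  haveI : (M).IsMaximal := hy ▸ IsLocalRing.maximalIdeal.isMaximal S
  haveI : IsRegularRing (S ⧸ M) := by letI := Ideal.Quotient.field (M); infer_instance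
  exact IsBlowup.isRegular_subscheme_comap_of_isQuasiRegular y
    (isQuasiRegular_regularSystemOfParameters hd y hy) (affineBlowup.isBlowup (M))

include hy in
/-- **`E` is reduced.** [cite: Liu2002, Thm. 8.1.19 (b)] -/
theorem isReduced_exceptional : IsReduced (𝓔).subscheme := by
  haveI : IsRegularRing S := isRegularRing_of_isRegularLocalRing S
  haveI : IsRegularRing (CommRingCat.of S) := inferInstanceAs (IsRegularRing S)
  haveI : (M).IsMaximal := hy ▸ IsLocalRing.maximalIdeal.isMaximal S
  haveI : IsRegularRing (S ⧸ M) := by letI := Ideal.Quotient.field (M); infer_instance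
  exact IsBlowup.isReduced_subscheme_comap (Scheme.isRegular_Spec _)
    (isRegular_subscheme_idealSheaf_of_quotient S (M)) (affineBlowup.isBlowup (M))

/-- **`E` is Noetherian** (a closed subscheme of the Noetherian `X`). [folklore] -/
theorem isNoetherian_exceptional : IsNoetherian (𝓔).subscheme := by
  haveI := isNoetherian_blowup y
  exact isNoetherian_subscheme _

omit [IsRegularLocalRing S] in
/-- The ideal of `i : E ⟶ X` is the exceptional ideal, an effective Cartier divisor. [folklore] -/
theorem ker_subschemeι_isEffectiveCartier : IsEffectiveCartier (𝓔).subschemeι.ker := by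
  rw [Scheme.IdealSheafData.ker_subschemeι]
  exact (affineBlowup.isBlowup (M)).isEffectiveCartier

include hy in
/-- **`E` lies over the closed point.** [folklore] -/
theorem map_exceptional_eq_closedPoint (e : (𝓔).subscheme) :
    (g).base ((𝓔).subschemeι.base e) = IsLocalRing.closedPoint S := by
  have h : (𝓔).subschemeι.base e ∈ Set.range (𝓔).subschemeι.base := ⟨e, rfl⟩
  rw [Scheme.IdealSheafData.range_subschemeι] at h
  exact support_comap_idealSheaf_maximalIdeal_subset hy _ h

include hy hd in
/-- **`E` is irreducible** (the exceptional fibre of the blow-up of a quasi-regular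
maximal centre; tree `affineBlowup.isIrreducible_preimage_of_isQuasiRegular`).
[cite: Liu2002, Thm. 8.1.19 (b)] -/
theorem irreducibleSpace_exceptional : IrreducibleSpace (𝓔).subscheme := by
  haveI hmax : (M).IsMaximal := hy ▸ IsLocalRing.maximalIdeal.isMaximal S
  have hirr := affineBlowup.isIrreducible_preimage_of_isQuasiRegular y
    (isQuasiRegular_regularSystemOfParameters hd y hy) hmax
  -- the support of `𝔪𝒪_X` is the preimage of the closed point
  have hsupp : ((𝓔).support : Set X) =
      (g) ⁻¹' {(⟨M, hmax.isPrime⟩ : PrimeSpectrum S)} := by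
    rw [Scheme.IdealSheafData.support_comap, Closeds.coe_preimage, affineBlowup.support_idealSheaf]
    congr 1
    ext p
    change (M : Set S) ⊆ p.asIdeal ↔ p = _
    constructor
    · intro h
      exact PrimeSpectrum.ext (hmax.eq_of_le p.2.ne_top h).symm
    · rintro rfl; exact le_rfl
  rw [← hsupp, ← Scheme.IdealSheafData.range_subschemeι] at hirr
  haveI : IrreducibleSpace (Set.range (𝓔).subschemeι.base) :=
    isIrreducible_iff_irreducibleSpace.mp hirr
  exact ((𝓔).subschemeι.isClosedEmbedding.isEmbedding.toHomeomorph).irreducibleSpace_iff.mpr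
    inferInstance

include hy hd in
/-- **`E` is an integral scheme** (irreducible and reduced). [cite: Liu2002, Thm. 8.1.19 (b)] -/
theorem isIntegral_exceptional : IsIntegral (𝓔).subscheme := by
  haveI := irreducibleSpace_exceptional y hy hd
  haveI := isReduced_exceptional y hy
  exact isIntegral_of_irreducibleSpace_of_isReduced _

omit [IsRegularLocalRing S] in
/-- **`E` is a scheme over the residue field**: a morphism `E ⟶ Spec (S ⧸ 𝔪)` through which
`E → X → Spec S` factors (the composite pulls `𝔪~` back to `𝓘_E|_E = 0`). [folklore] -/
theorem exists_hom_exceptional_residueField :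
    ∃ ℓ : (𝓔).subscheme ⟶ Spec (.of (S ⧸ M)),
      ℓ ≫ Spec.map (CommRingCat.ofHom (Ideal.Quotient.mk (M))) = (𝓔).subschemeι ≫ g := by
  have hker : (Spec.map (CommRingCat.ofHom (Ideal.Quotient.mk (M)))).ker ≤
      ((𝓔).subschemeι ≫ g).ker := by
    rw [ker_specMap_quotient_mk, le_ker_iff_comap_eq_bot, Scheme.IdealSheafData.comap_comp]
    have h := comap_ker_self (𝓔).subschemeι
    rwa [Scheme.IdealSheafData.ker_subschemeι] at h
  haveI : IsClosedImmersion (Spec.map (CommRingCat.ofHom (Ideal.Quotient.mk (M)))) :=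
    IsClosedImmersion.spec_of_surjective _ Ideal.Quotient.mk_surjective
  exact ⟨IsClosedImmersion.lift _ _ hker, IsClosedImmersion.lift_fac _ _ hker⟩

include hy in
/-- **`E` is excellent**: of finite type over the field `S ⧸ 𝔪` (EGA IV 7.8.6; tree
`Scheme.IsExcellent.of_locallyOfFiniteType`, `isExcellentRing_of_field`) — no excellence of `S`
needed. [cite: EGAIV2, Prop. 7.8.6 (i)] -/
theorem isExcellent_exceptional : Scheme.IsExcellent (𝓔).subscheme := by
  haveI hmax : (M).IsMaximal := hy ▸ IsLocalRing.maximalIdeal.isMaximal S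
  letI : Field (S ⧸ M) := Ideal.Quotient.field (M)
  obtain ⟨ℓ, hℓ⟩ := exists_hom_exceptional_residueField y
  haveI : IsProper (g) := (affineBlowup.isBlowup (M)).isProper
  haveI : LocallyOfFiniteType ((𝓔).subschemeι ≫ g) := inferInstance
  haveI : LocallyOfFiniteType (ℓ ≫ Spec.map (CommRingCat.ofHom (Ideal.Quotient.mk (M)))) := by
    rw [hℓ]; infer_instance
  haveI : LocallyOfFiniteType ℓ := locallyOfFiniteType_of_comp ℓ
    (Spec.map (CommRingCat.ofHom (Ideal.Quotient.mk (M))))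
  haveI := isNoetherian_exceptional y
  exact Scheme.IsExcellent.of_locallyOfFiniteType ℓ
    (Scheme.isExcellent_Spec_of_isExcellentRing (S ⧸ M) (isExcellentRing_of_field _))

end Exceptional

end DepthOne

end Summit.ResolutionOfSingularities.ResolutionOfSingularities.Theorems

end
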